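import Summits.BirchSwinnertonDyer.BirchSwinnertonDyer.Theses.LeadingTerm
import Literature.NumberTheory.EllipticCurves.SelmerCorankHolds
import HarnessLib

/-!
# Crux `SqueezeUBR2` (stmt-BirchSwinnertonDyer-0145) — round-2 ideator k4 sketch

Idea `mock-plectic-nonsplit-ignition`: the first open cell of UB ("no elliptic curve over ℚ with
analytic rank exactly 2 has more than two independent rational points", `NoExcessAtTwo`) restricted
to the NON-SPLIT MULTIPLICATIVE SECTOR follows from two statements about ONE abstract non-vanishing
predicate `Q W d p` (intended meaning: "the Fornea–Gehrmann mock plectic invariant 𝒬_K of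
(E_W, K = ℚ(√d), p) is non-zero", arXiv:2311.03100 eq. (MPI); not definable in the tree today —
definition request D1 of the card):
* `CapShape Q`      — Fornea–Gehrmann 2023 Thm 1.1 (PRINTED): 𝒬_K ≠ 0 ⇒ corank Sel_{p^∞}(E/ℚ) ≤ 2
                      (their `max {r_p(E^±/ℚ) + δ^±_p} = 2`, δ⁺ = 0 at a non-split prime);
* `IgnitionShape Q` — the r_an-keyed mock plectic conjecture (OPEN; the card's crux):
                      r_an(E) = 2 on the sector ⇒ ∃ (d, p), 𝒬_{K_d,p}(E) ≠ 0.
The composition uses only the PROVED corank identity `selmerCorank = rank + shaCorank`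
(`WeierstrassCurve.selmerCorank_eq_mordellWeilRank_add_holds`, Greenberg 1999 §1).
-/

namespace Summit.BirchSwinnertonDyer.BirchSwinnertonDyer.Cruxes.SqueezeUB.IdeasR2K4

open Literature.NumberTheory.EllipticCurves
open Summit.BirchSwinnertonDyer.BirchSwinnertonDyer.Theses.LeadingTerm (SqueezeUBR2)

/-- The first open cell of UB, stated pointwise at analytic rank 2 (= strategist's `NoExcessAt 2`
up to the harmless `4 ≤ rank` guard: ranks 3 are excluded by parity only, so we state the honest
`≤ 2`). [folklore] -/
def NoExcessAtTwo : Prop :=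
  ∀ (W : WeierstrassCurve ℚ) [W.IsElliptic] [W.IsGloballyMinimal],
    W.analyticRank = 2 → W.mordellWeilRank ≤ 2

/-- The crux gives the cell (restriction). [folklore] -/
theorem noExcessAtTwo_of_squeezeUBR2 (h : SqueezeUBR2) : NoExcessAtTwo :=
  fun W _ _ h2 => h2 ▸ h W

/-- The NON-SPLIT MULTIPLICATIVE SECTOR: `E_W` has a prime `p ≥ 5` of multiplicative, non-split
reduction with surjective mod-`p` Galois image (Fornea–Gehrmann's standing hypotheses, minus the
auxiliary-field conditions, which are existentially quantified inside `Q`). [cite: arXiv:2311.03100, §1] -/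
def NonsplitSector (W : WeierstrassCurve ℚ) : Prop :=
  ∃ (p : ℕ) (_ : Fact p.Prime), 5 ≤ p ∧ W.HasMultiplicativeReductionAtPrime p ∧
    ¬ W.HasSplitMultiplicativeReductionAtPrime p ∧ W.HasSurjectiveModNGaloisRep (p : ℤ)

/-- The first cell on the non-split multiplicative sector. [folklore] -/
def NoExcessAtTwoNonsplit : Prop :=
  ∀ (W : WeierstrassCurve ℚ) [W.IsElliptic] [W.IsGloballyMinimal],
    NonsplitSector W → W.analyticRank = 2 → W.mordellWeilRank ≤ 2

/-- FORNEA–GEHRMANN CAP SHAPE (arXiv:2311.03100 Thm 1.1, printed): non-vanishing of the mock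
plectic invariant at `(W, d, p)` caps the `p^∞`-Selmer corank of `E_W/ℚ` by `2` (their conclusion
`max{r_p(E⁺/ℚ)+δ⁺, r_p(E⁻/ℚ)+δ⁻} = 2` with `δ⁺ = 0` because `p` is NON-split for `E⁺ = E`).
Stated over an abstract predicate `Q` because 𝒬_K is not yet definable in the tree.
[cite: arXiv:2311.03100, Thm 1.1] -/
def CapShape (Q : WeierstrassCurve ℚ → ℤ → ℕ → Prop) : Prop :=
  ∀ (W : WeierstrassCurve ℚ) [W.IsElliptic] (d : ℤ) (p : ℕ) [Fact p.Prime],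
    Q W d p → W.selmerCorank p ≤ 2

/-- IGNITION SHAPE (the card's crux, OPEN, r_an-keyed mock plectic conjecture): analytic rank
exactly `2` on the sector forces the mock plectic invariant to be non-zero for SOME auxiliary
imaginary quadratic field `ℚ(√d)` (with `p` inert, `w(E/K)=+1`, `L(E^d,1) ≠ 0`) and some sector
prime `p`. Compare Darmon–Fornea Conj. 3.9 (rank-keyed) and Fornea–Gehrmann Conj. (Conj1).
[cite: arXiv:2310.16758, Conj. 3.9] -/
def IgnitionShape (Q : WeierstrassCurve ℚ → ℤ → ℕ → Prop) : Prop :=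
  ∀ (W : WeierstrassCurve ℚ) [W.IsElliptic] [W.IsGloballyMinimal],
    NonsplitSector W → W.analyticRank = 2 → ∃ (d : ℤ) (p : ℕ) (_ : Fact p.Prime), Q W d p

/-- **First lemma of the line.** Cap (printed) + ignition (open) ⇒ the first cell on the non-split
multiplicative sector, via the PROVED corank identity `corank Sel_{p^∞} = rank + corank Ш[p^∞]`.
No Ш-finiteness, no height, no main conjecture enters. [folklore] -/
theorem noExcessAtTwoNonsplit_of_cap_of_ignition (Q : WeierstrassCurve ℚ → ℤ → ℕ → Prop)
    (hcap : CapShape Q) (hign : IgnitionShape Q) : NoExcessAtTwoNonsplit := by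
  intro W _ _ hS h2
  obtain ⟨d, p, hp, hQ⟩ := hign W hS h2
  have hc : W.selmerCorank p ≤ 2 := hcap W d p hQ
  have hid : W.selmerCorank p = W.mordellWeilRank + W.shaCorank p :=
    W.selmerCorank_eq_mordellWeilRank_add_holds p
  omega

/-- Sanity (costume check recorded honestly): the crux itself implies the sector cell, so the
line's content is entirely in `IgnitionShape` for the INTENDED `Q`; with an arbitrary `Q` the two
shapes are jointly satisfiable by `Q := fun W _ p => W.selmerCorank p ≤ 2` IFF the Selmer-level
cell holds — i.e. the abstract interface carries no content beyond bookkeeping. [folklore] -/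
theorem capShape_of_trivialQ : CapShape (fun W _ p => ∀ [Fact p.Prime], W.selmerCorank p ≤ 2) :=
  fun W _ d p _ h => h

end Summit.BirchSwinnertonDyer.BirchSwinnertonDyer.Cruxes.SqueezeUB.IdeasR2K4
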